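import Mathlib
import Summits.PneNP.PneNP.Theorems.OverlapGapAlgebraSolvableImpliesStableSectionMonotoneRepairTreeFamily
import Summits.PneNP.PneNP.Theorems.OverlapGapAlgebraSolvableImpliesStableSectionMonotoneRepairTreeCompose

/-!
# PneNP / OverlapGapAlgebra — crux `SolvableImpliesStableSection` (stmt-PneNP-2463):
# the MONOTONE REPAIR block (7/·) — tree codes: one step of the weight recursion

Support for crux `stmt-PneNP-2463` (`Summit.PneNP.PneNP.Theses.OverlapGapAlgebra.SolvableImpliesStableSection`):
the f-free block "bounded-round monotone repair gives stable sections up to `α ≤ 2^k/(4k)`".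
The WEIGHT of a tree code is `wt(T) = ∏_{e ∈ T} 2^{-k}·(1 if root else 1/n)`; summed over the codes
of a given shape class it is the expected number of such witness trees per clause.  Writing `U` for the
locally valid codes of `TS d` with a childless root slot and root round `< r`, and `Rec ⊆ U` for those
of root round `r - 1`, this file bounds the total weight of the codes of `TS (d+1)` of root round `r`:

* `sissR_sum_cover_le` — a sum over a covered set is at most the sum of the sums over the cover;
* `sissR_weight_recent` — locally valid codes with a child of round `r - 1` at the root:
  total weight `≤ m·k·2^{-k}·(∑_{Rec} wt / n)·(1 + ∑_U wt / n)^{k-1}` (decompose `T = asm c r ch`,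
  `sissR_wt_asm`, and `∑_{ch} ∏_j f(ch j) = ∏_j ∑ f`);
* `sissR_weight_full` — locally valid codes all of whose root slots bear children:
  total weight `≤ m·2^{-k}·(∑_U wt / n)^k`;
* `sissR_weight_zero` — root round `0`: total weight `≤ m·2^{-k}`;
* `sissR_weight_base_empty` — no bare root (`TS 0`) of round `≥ 1` is locally valid.
No definitions (all objects are hypotheses); axioms `propext`, `Classical.choice`, `Quot.sound`.
-/

set_option linter.dupNamespace false -- `Summit.PneNP.PneNP.…`: summit = sub-problem (D-0017)

namespace Summit.PneNP.PneNP.Theorems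

open Finset
open scoped Classical

section WeightStep

variable {m k n : ℕ}

/-- **Sums over a covered set.** If every element of `s` lies in some `t i`, `i ∈ I`, and `g ≥ 0`, then
`∑_{x ∈ s} g x ≤ ∑_{i ∈ I} ∑_{x ∈ t i} g x`. -/
theorem sissR_sum_cover_le {α ι : Type*} (s : Finset α) (I : Finset ι) (t : ι → Finset α)
    (g : α → ℝ) (hg : ∀ x, 0 ≤ g x) (hcover : ∀ x ∈ s, ∃ i ∈ I, x ∈ t i) :
    ∑ x ∈ s, g x ≤ ∑ i ∈ I, ∑ x ∈ t i, g x := by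
  calc ∑ x ∈ s, g x ≤ ∑ x ∈ s, ∑ i ∈ I, (if x ∈ t i then g x else 0) := by
        refine Finset.sum_le_sum fun x hx => ?_
        obtain ⟨i, hi, hxi⟩ := hcover x hx
        calc g x = (if x ∈ t i then g x else 0) := by rw [if_pos hxi]
          _ ≤ ∑ i ∈ I, (if x ∈ t i then g x else 0) :=
            Finset.single_le_sum (f := fun i => if x ∈ t i then g x else 0)
              (fun i _ => by by_cases h : x ∈ t i <;> simp [h, hg x]) hi
    _ = ∑ i ∈ I, ∑ x ∈ s, (if x ∈ t i then g x else 0) := Finset.sum_comm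
    _ ≤ ∑ i ∈ I, ∑ x ∈ t i, g x := by
        refine Finset.sum_le_sum fun i _ => ?_
        rw [← Finset.sum_filter]
        exact Finset.sum_le_sum_of_subset_of_nonneg (fun x hx => (Finset.mem_filter.1 hx).2)
          (fun x _ _ => hg x)

/-- The weight of a code is nonnegative. -/
theorem sissR_wt_nonneg (T : Finset (List (Fin k) × (Fin m × ℕ))) : 0 ≤ ∏ e ∈ T, ((1 / 2 : ℝ) ^ k * (if e.1 = [] then (1 : ℝ) else 1 / (n : ℝ))) :=
  Finset.prod_nonneg fun e _ => mul_nonneg (pow_nonneg (by norm_num) _)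
    (by split_ifs <;> positivity)

/-- **Weight of the codes with a recent child at the root.** Let `U` be the locally valid codes of
`TS d` with a childless root slot and root round `< r`, and `Rec` those with root round `r - 1`.
The locally valid codes of `TS (d+1)` with root round `r` and a child of round `r - 1` at the root have
total weight at most `m·k·2^{-k}·(∑_{Rec} wt / n)·(1 + ∑_U wt / n)^{k-1}`. -/
theorem sissR_weight_recent (asm : Fin m → ℕ → (Fin k → Option (Finset (List (Fin k) × (Fin m × ℕ)))) → Finset (List (Fin k) × (Fin m × ℕ)))
    (hasm : ∀ (c : Fin m) (r : ℕ) (ch : Fin k → Option (Finset (List (Fin k) × (Fin m × ℕ))))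
      (e : (List (Fin k) × (Fin m × ℕ))), e ∈ asm c r ch ↔ (e = ([], (c, r)) ∨
      ∃ (j : Fin k) (S : Finset (List (Fin k) × (Fin m × ℕ))), ch j = some S ∧
        ∃ b : List (Fin k), (b, e.2) ∈ S ∧ e.1 = b ++ [j]))
    (TS : ℕ → Finset (Finset (List (Fin k) × (Fin m × ℕ)))) (L : ℕ)
    (hTS0 : ∀ T : Finset (List (Fin k) × (Fin m × ℕ)), T ∈ TS 0 ↔
      ∃ (c : Fin m) (r : ℕ), r ≤ L ∧ T = asm c r (fun _ => none))
    (hTSs : ∀ (d : ℕ) (T : Finset (List (Fin k) × (Fin m × ℕ))), T ∈ TS (d + 1) ↔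
      ∃ (c : Fin m) (r : ℕ), r ≤ L ∧ ∃ ch : Fin k → Option (Finset (List (Fin k) × (Fin m × ℕ))),
        (∀ (j : Fin k) (S : Finset (List (Fin k) × (Fin m × ℕ))), ch j = some S → S ∈ TS d) ∧ T = asm c r ch)
    (d r : ℕ) :
    ∑ T ∈ (TS (d + 1)).filter (fun T => ((∀ e ∈ T, ∀ (j : Fin k) (y : Fin m) (s : ℕ), (j :: e.1, (y, s)) ∈ T →
        s < e.2.2 ∧ ∃ j' : Fin k, ∀ lab : Fin m × ℕ, (j' :: j :: e.1, lab) ∉ T) ∧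
      (∀ e ∈ T, 1 ≤ e.2.2 → (∃ (j : Fin k) (y : Fin m), (j :: e.1, (y, e.2.2 - 1)) ∈ T) ∨
        (e.1 = [] ∧ ∀ j : Fin k, ∃ lab : Fin m × ℕ, ([j], lab) ∈ T))) ∧
        (∃ y : Fin m, (([] : List (Fin k)), (y, r)) ∈ T) ∧
        ∃ (j : Fin k) (y : Fin m), ([j], (y, r - 1)) ∈ T), (∏ e ∈ T, ((1 / 2 : ℝ) ^ k * (if e.1 = [] then (1 : ℝ) else 1 / (n : ℝ))))
      ≤ (m : ℝ) * k * (1 / 2 : ℝ) ^ k *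
        ((∑ S ∈ (TS d).filter (fun S => ((∀ e ∈ S, ∀ (j : Fin k) (y : Fin m) (s : ℕ), (j :: e.1, (y, s)) ∈ S →
        s < e.2.2 ∧ ∃ j' : Fin k, ∀ lab : Fin m × ℕ, (j' :: j :: e.1, lab) ∉ S) ∧
      (∀ e ∈ S, 1 ≤ e.2.2 → (∃ (j : Fin k) (y : Fin m), (j :: e.1, (y, e.2.2 - 1)) ∈ S) ∨
        (e.1 = [] ∧ ∀ j : Fin k, ∃ lab : Fin m × ℕ, ([j], lab) ∈ S))) ∧ (∃ j : Fin k, ∀ lab : Fin m × ℕ, ([j], lab) ∉ S) ∧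
            ∃ y : Fin m, (([] : List (Fin k)), (y, r - 1)) ∈ S), (∏ e ∈ S, ((1 / 2 : ℝ) ^ k * (if e.1 = [] then (1 : ℝ) else 1 / (n : ℝ))))) / n) *
        (1 + (∑ S ∈ (TS d).filter (fun S => ((∀ e ∈ S, ∀ (j : Fin k) (y : Fin m) (s : ℕ), (j :: e.1, (y, s)) ∈ S →
        s < e.2.2 ∧ ∃ j' : Fin k, ∀ lab : Fin m × ℕ, (j' :: j :: e.1, lab) ∉ S) ∧
      (∀ e ∈ S, 1 ≤ e.2.2 → (∃ (j : Fin k) (y : Fin m), (j :: e.1, (y, e.2.2 - 1)) ∈ S) ∨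
        (e.1 = [] ∧ ∀ j : Fin k, ∃ lab : Fin m × ℕ, ([j], lab) ∈ S))) ∧ (∃ j : Fin k, ∀ lab : Fin m × ℕ, ([j], lab) ∉ S) ∧
            ∃ (y : Fin m) (s : ℕ), (([] : List (Fin k)), (y, s)) ∈ S ∧ s < r), (∏ e ∈ S, ((1 / 2 : ℝ) ^ k * (if e.1 = [] then (1 : ℝ) else 1 / (n : ℝ))))) / n) ^ (k - 1) := by
  -- the option sets offered to each slot
  set U : Finset (Finset (List (Fin k) × (Fin m × ℕ))) := (TS d).filter (fun S => ((∀ e ∈ S, ∀ (j : Fin k) (y : Fin m) (s : ℕ), (j :: e.1, (y, s)) ∈ S →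
        s < e.2.2 ∧ ∃ j' : Fin k, ∀ lab : Fin m × ℕ, (j' :: j :: e.1, lab) ∉ S) ∧
      (∀ e ∈ S, 1 ≤ e.2.2 → (∃ (j : Fin k) (y : Fin m), (j :: e.1, (y, e.2.2 - 1)) ∈ S) ∨
        (e.1 = [] ∧ ∀ j : Fin k, ∃ lab : Fin m × ℕ, ([j], lab) ∈ S))) ∧ (∃ j : Fin k, ∀ lab : Fin m × ℕ, ([j], lab) ∉ S) ∧
      ∃ (y : Fin m) (s : ℕ), (([] : List (Fin k)), (y, s)) ∈ S ∧ s < r) with hU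
  set Rec : Finset (Finset (List (Fin k) × (Fin m × ℕ))) := (TS d).filter (fun S => ((∀ e ∈ S, ∀ (j : Fin k) (y : Fin m) (s : ℕ), (j :: e.1, (y, s)) ∈ S →
        s < e.2.2 ∧ ∃ j' : Fin k, ∀ lab : Fin m × ℕ, (j' :: j :: e.1, lab) ∉ S) ∧
      (∀ e ∈ S, 1 ≤ e.2.2 → (∃ (j : Fin k) (y : Fin m), (j :: e.1, (y, e.2.2 - 1)) ∈ S) ∨
        (e.1 = [] ∧ ∀ j : Fin k, ∃ lab : Fin m × ℕ, ([j], lab) ∈ S))) ∧ (∃ j : Fin k, ∀ lab : Fin m × ℕ, ([j], lab) ∉ S) ∧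
      ∃ y : Fin m, (([] : List (Fin k)), (y, r - 1)) ∈ S) with hRec
  set f : Option (Finset (List (Fin k) × (Fin m × ℕ))) → ℝ := fun o => o.elim (1 : ℝ) (fun S => (∏ e ∈ S, ((1 / 2 : ℝ) ^ k * (if e.1 = [] then (1 : ℝ) else 1 / (n : ℝ)))) / n) with hf
  set t : Fin k → Fin k → Finset (Option (Finset (List (Fin k) × (Fin m × ℕ)))) := fun j₀ j =>
    if j = j₀ then Rec.image some else insertNone U with ht
  have hf0 : ∀ o, 0 ≤ f o := by
    intro o; cases o with
    | none => simp [hf]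
    | some S => simp only [hf, Option.elim_some]; exact div_nonneg (sissR_wt_nonneg S) (Nat.cast_nonneg _)
  -- members of `t j₀ j` are `none` or trees of `TS d`
  have ht_TS : ∀ (j₀ j : Fin k) (S : Finset (List (Fin k) × (Fin m × ℕ))), some S ∈ t j₀ j → S ∈ TS d := by
    intro j₀ j S h
    simp only [ht] at h
    split_ifs at h with hj
    · rw [Finset.mem_image] at h
      obtain ⟨S', hS', hSS⟩ := h
      cases hSS
      exact (Finset.mem_filter.1 hS').1
    · rw [Finset.some_mem_insertNone] at h
      exact (Finset.mem_filter.1 h).1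
  -- (1) decomposition of the trees in the class
  have hdecomp : ∀ T ∈ (TS (d + 1)).filter (fun T => ((∀ e ∈ T, ∀ (j : Fin k) (y : Fin m) (s : ℕ), (j :: e.1, (y, s)) ∈ T →
        s < e.2.2 ∧ ∃ j' : Fin k, ∀ lab : Fin m × ℕ, (j' :: j :: e.1, lab) ∉ T) ∧
      (∀ e ∈ T, 1 ≤ e.2.2 → (∃ (j : Fin k) (y : Fin m), (j :: e.1, (y, e.2.2 - 1)) ∈ T) ∨
        (e.1 = [] ∧ ∀ j : Fin k, ∃ lab : Fin m × ℕ, ([j], lab) ∈ T))) ∧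
        (∃ y : Fin m, (([] : List (Fin k)), (y, r)) ∈ T) ∧
        ∃ (j : Fin k) (y : Fin m), ([j], (y, r - 1)) ∈ T),
      ∃ p ∈ (univ : Finset (Fin m × Fin k)),
        T ∈ (Fintype.piFinset (t p.2)).image (fun ch => asm p.1 r ch) := by
    intro T hT
    rw [Finset.mem_filter] at hT
    obtain ⟨hTS, hloc, ⟨y, hy⟩, j₀, y₀, hy₀⟩ := hT
    obtain ⟨c, r', _, ch, hch, rfl⟩ := (hTSs d _).1 hTS
    -- the root round is `r`
    have hrr : r' = r := by
      have := (sissR_asm_mem_nil asm hasm c r' ch (y, r)).1 hy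
      exact ((Prod.mk.inj this).2).symm
    subst hrr
    -- subtrees have roots
    have hroots : ∀ (j : Fin k) (S : Finset (List (Fin k) × (Fin m × ℕ))), ch j = some S →
        ∃ lab : Fin m × ℕ, (([] : List (Fin k)), lab) ∈ S := by
      intro j S hS
      obtain ⟨⟨c', r'', _, h⟩, _⟩ := sissR_TS_valid asm hasm TS L hTS0 hTSs d S (hch j S hS)
      exact ⟨(c', r''), h⟩
    obtain ⟨hsub, _⟩ := sissR_locv_asm_imp asm hasm c r' ch hroots hloc
    refine ⟨(c, j₀), mem_univ _, ?_⟩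
    rw [Finset.mem_image]
    refine ⟨ch, ?_, rfl⟩
    rw [Fintype.mem_piFinset]
    intro j
    simp only [ht]
    split_ifs with hj
    · -- the recent slot
      subst hj
      obtain ⟨S, hS, hyS⟩ := (sissR_asm_mem_single asm hasm c r' ch j (y₀, r' - 1)).1 hy₀
      rw [hS, Finset.mem_image]
      refine ⟨S, ?_, rfl⟩
      rw [hRec, Finset.mem_filter]
      obtain ⟨hl, hn, _⟩ := hsub j S hS
      exact ⟨hch j S hS, hl, hn, y₀, hyS⟩
    · cases hS : ch j with
      | none => exact Finset.none_mem_insertNone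
      | some S =>
        rw [Finset.some_mem_insertNone, hU, Finset.mem_filter]
        obtain ⟨hl, hn, hlt⟩ := hsub j S hS
        obtain ⟨lab, hlab⟩ := hroots j S hS
        exact ⟨hch j S hS, hl, hn, lab.1, lab.2, hlab, hlt lab.1 lab.2 hlab⟩
  -- (2) cover, (3) sum over the image ≤ sum over the assembling data
  refine (sissR_sum_cover_le _ _ _ _ sissR_wt_nonneg hdecomp).trans ?_
  have hinner : ∀ p : Fin m × Fin k,
      ∑ T ∈ (Fintype.piFinset (t p.2)).image (fun ch => asm p.1 r ch), (∏ e ∈ T, ((1 / 2 : ℝ) ^ k * (if e.1 = [] then (1 : ℝ) else 1 / (n : ℝ))))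
        ≤ (1 / 2 : ℝ) ^ k * (((∑ S ∈ Rec, (∏ e ∈ S, ((1 / 2 : ℝ) ^ k * (if e.1 = [] then (1 : ℝ) else 1 / (n : ℝ))))) / n) *
            (1 + (∑ S ∈ U, (∏ e ∈ S, ((1 / 2 : ℝ) ^ k * (if e.1 = [] then (1 : ℝ) else 1 / (n : ℝ))))) / n) ^ (k - 1)) := by
    rintro ⟨c, j₀⟩
    refine (Finset.sum_image_le_of_nonneg fun T _ => sissR_wt_nonneg T).trans ?_
    -- (4) the weight of each assembled code
    have hw : ∀ ch ∈ Fintype.piFinset (t j₀),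
        (∏ e ∈ asm c r ch, ((1 / 2 : ℝ) ^ k * (if e.1 = [] then (1 : ℝ) else 1 / (n : ℝ)))) = (1 / 2 : ℝ) ^ k * ∏ j : Fin k, f (ch j) := by
      intro ch hch
      rw [Fintype.mem_piFinset] at hch
      refine sissR_wt_asm asm hasm c r ch fun j S hS => ?_
      exact sissR_TS_rootCount asm hasm TS L hTS0 hTSs d S (ht_TS j₀ j S (by rw [← hS]; exact hch j))
    rw [Finset.sum_congr rfl hw, ← Finset.mul_sum, ← Finset.prod_univ_sum]
    refine mul_le_mul_of_nonneg_left (le_of_eq ?_) (pow_nonneg (by norm_num) _)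
    -- (5) the product over the slots
    have hX : ∑ o ∈ insertNone U, f o = 1 + (∑ S ∈ U, (∏ e ∈ S, ((1 / 2 : ℝ) ^ k * (if e.1 = [] then (1 : ℝ) else 1 / (n : ℝ))))) / n := by
      rw [Finset.sum_insertNone]
      simp only [hf, Option.elim_none, Option.elim_some]
      rw [Finset.sum_div]
    have hA : ∑ o ∈ Rec.image some, f o = (∑ S ∈ Rec, (∏ e ∈ S, ((1 / 2 : ℝ) ^ k * (if e.1 = [] then (1 : ℝ) else 1 / (n : ℝ))))) / n := by
      rw [Finset.sum_image (fun S _ S' _ h => Option.some_injective _ h)]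
      simp only [hf, Option.elim_some]
      rw [Finset.sum_div]
    rw [← Finset.mul_prod_erase (univ : Finset (Fin k)) _ (mem_univ j₀)]
    simp only [ht, if_pos rfl]
    rw [hA]
    congr 1
    rw [Finset.prod_congr rfl (fun j hj => by rw [if_neg (Finset.ne_of_mem_erase hj)]), Finset.prod_const,
      Finset.card_erase_of_mem (mem_univ j₀), Finset.card_univ, Fintype.card_fin, hX]
  refine (Finset.sum_le_sum fun p _ => hinner p).trans ?_
  rw [Finset.sum_const, Finset.card_univ, Fintype.card_prod, Fintype.card_fin, Fintype.card_fin,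
    nsmul_eq_mul]
  push_cast
  exact le_of_eq (by ring)

/-- **Weight of the full roots.** The locally valid codes of `TS (d+1)` with root round `r` all of
whose `k` root slots bear children have total weight at most `m·2^{-k}·(∑_U wt / n)^k`. -/
theorem sissR_weight_full (asm : Fin m → ℕ → (Fin k → Option (Finset (List (Fin k) × (Fin m × ℕ)))) → Finset (List (Fin k) × (Fin m × ℕ)))
    (hasm : ∀ (c : Fin m) (r : ℕ) (ch : Fin k → Option (Finset (List (Fin k) × (Fin m × ℕ))))
      (e : (List (Fin k) × (Fin m × ℕ))), e ∈ asm c r ch ↔ (e = ([], (c, r)) ∨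
      ∃ (j : Fin k) (S : Finset (List (Fin k) × (Fin m × ℕ))), ch j = some S ∧
        ∃ b : List (Fin k), (b, e.2) ∈ S ∧ e.1 = b ++ [j]))
    (TS : ℕ → Finset (Finset (List (Fin k) × (Fin m × ℕ)))) (L : ℕ)
    (hTS0 : ∀ T : Finset (List (Fin k) × (Fin m × ℕ)), T ∈ TS 0 ↔
      ∃ (c : Fin m) (r : ℕ), r ≤ L ∧ T = asm c r (fun _ => none))
    (hTSs : ∀ (d : ℕ) (T : Finset (List (Fin k) × (Fin m × ℕ))), T ∈ TS (d + 1) ↔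
      ∃ (c : Fin m) (r : ℕ), r ≤ L ∧ ∃ ch : Fin k → Option (Finset (List (Fin k) × (Fin m × ℕ))),
        (∀ (j : Fin k) (S : Finset (List (Fin k) × (Fin m × ℕ))), ch j = some S → S ∈ TS d) ∧ T = asm c r ch)
    (d r : ℕ) :
    ∑ T ∈ (TS (d + 1)).filter (fun T => ((∀ e ∈ T, ∀ (j : Fin k) (y : Fin m) (s : ℕ), (j :: e.1, (y, s)) ∈ T →
        s < e.2.2 ∧ ∃ j' : Fin k, ∀ lab : Fin m × ℕ, (j' :: j :: e.1, lab) ∉ T) ∧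
      (∀ e ∈ T, 1 ≤ e.2.2 → (∃ (j : Fin k) (y : Fin m), (j :: e.1, (y, e.2.2 - 1)) ∈ T) ∨
        (e.1 = [] ∧ ∀ j : Fin k, ∃ lab : Fin m × ℕ, ([j], lab) ∈ T))) ∧
        (∃ y : Fin m, (([] : List (Fin k)), (y, r)) ∈ T) ∧
        ∀ j : Fin k, ∃ lab : Fin m × ℕ, ([j], lab) ∈ T), (∏ e ∈ T, ((1 / 2 : ℝ) ^ k * (if e.1 = [] then (1 : ℝ) else 1 / (n : ℝ))))
      ≤ (m : ℝ) * (1 / 2 : ℝ) ^ k *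
        ((∑ S ∈ (TS d).filter (fun S => ((∀ e ∈ S, ∀ (j : Fin k) (y : Fin m) (s : ℕ), (j :: e.1, (y, s)) ∈ S →
        s < e.2.2 ∧ ∃ j' : Fin k, ∀ lab : Fin m × ℕ, (j' :: j :: e.1, lab) ∉ S) ∧
      (∀ e ∈ S, 1 ≤ e.2.2 → (∃ (j : Fin k) (y : Fin m), (j :: e.1, (y, e.2.2 - 1)) ∈ S) ∨
        (e.1 = [] ∧ ∀ j : Fin k, ∃ lab : Fin m × ℕ, ([j], lab) ∈ S))) ∧ (∃ j : Fin k, ∀ lab : Fin m × ℕ, ([j], lab) ∉ S) ∧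
            ∃ (y : Fin m) (s : ℕ), (([] : List (Fin k)), (y, s)) ∈ S ∧ s < r), (∏ e ∈ S, ((1 / 2 : ℝ) ^ k * (if e.1 = [] then (1 : ℝ) else 1 / (n : ℝ))))) / n) ^ k := by
  set U : Finset (Finset (List (Fin k) × (Fin m × ℕ))) := (TS d).filter (fun S => ((∀ e ∈ S, ∀ (j : Fin k) (y : Fin m) (s : ℕ), (j :: e.1, (y, s)) ∈ S →
        s < e.2.2 ∧ ∃ j' : Fin k, ∀ lab : Fin m × ℕ, (j' :: j :: e.1, lab) ∉ S) ∧
      (∀ e ∈ S, 1 ≤ e.2.2 → (∃ (j : Fin k) (y : Fin m), (j :: e.1, (y, e.2.2 - 1)) ∈ S) ∨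
        (e.1 = [] ∧ ∀ j : Fin k, ∃ lab : Fin m × ℕ, ([j], lab) ∈ S))) ∧ (∃ j : Fin k, ∀ lab : Fin m × ℕ, ([j], lab) ∉ S) ∧
      ∃ (y : Fin m) (s : ℕ), (([] : List (Fin k)), (y, s)) ∈ S ∧ s < r) with hU
  set f : Option (Finset (List (Fin k) × (Fin m × ℕ))) → ℝ := fun o => o.elim (1 : ℝ) (fun S => (∏ e ∈ S, ((1 / 2 : ℝ) ^ k * (if e.1 = [] then (1 : ℝ) else 1 / (n : ℝ)))) / n) with hf
  have hdecomp : ∀ T ∈ (TS (d + 1)).filter (fun T => ((∀ e ∈ T, ∀ (j : Fin k) (y : Fin m) (s : ℕ), (j :: e.1, (y, s)) ∈ T →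
        s < e.2.2 ∧ ∃ j' : Fin k, ∀ lab : Fin m × ℕ, (j' :: j :: e.1, lab) ∉ T) ∧
      (∀ e ∈ T, 1 ≤ e.2.2 → (∃ (j : Fin k) (y : Fin m), (j :: e.1, (y, e.2.2 - 1)) ∈ T) ∨
        (e.1 = [] ∧ ∀ j : Fin k, ∃ lab : Fin m × ℕ, ([j], lab) ∈ T))) ∧
        (∃ y : Fin m, (([] : List (Fin k)), (y, r)) ∈ T) ∧
        ∀ j : Fin k, ∃ lab : Fin m × ℕ, ([j], lab) ∈ T),
      ∃ c ∈ (univ : Finset (Fin m)),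
        T ∈ (Fintype.piFinset (fun _ : Fin k => U.image some)).image (fun ch => asm c r ch) := by
    intro T hT
    rw [Finset.mem_filter] at hT
    obtain ⟨hTS, hloc, ⟨y, hy⟩, hall⟩ := hT
    obtain ⟨c, r', _, ch, hch, rfl⟩ := (hTSs d _).1 hTS
    have hrr : r' = r := by
      have := (sissR_asm_mem_nil asm hasm c r' ch (y, r)).1 hy
      exact ((Prod.mk.inj this).2).symm
    subst hrr
    have hroots : ∀ (j : Fin k) (S : Finset (List (Fin k) × (Fin m × ℕ))), ch j = some S →
        ∃ lab : Fin m × ℕ, (([] : List (Fin k)), lab) ∈ S := by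
      intro j S hS
      obtain ⟨⟨c', r'', _, h⟩, _⟩ := sissR_TS_valid asm hasm TS L hTS0 hTSs d S (hch j S hS)
      exact ⟨(c', r''), h⟩
    obtain ⟨hsub, _⟩ := sissR_locv_asm_imp asm hasm c r' ch hroots hloc
    refine ⟨c, mem_univ _, ?_⟩
    rw [Finset.mem_image]
    refine ⟨ch, ?_, rfl⟩
    rw [Fintype.mem_piFinset]
    intro j
    obtain ⟨lab, hlab⟩ := hall j
    obtain ⟨S, hS, hlabS⟩ := (sissR_asm_mem_single asm hasm c r' ch j lab).1 hlab
    rw [hS, Finset.mem_image]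
    refine ⟨S, ?_, rfl⟩
    rw [hU, Finset.mem_filter]
    obtain ⟨hl, hn, hlt⟩ := hsub j S hS
    exact ⟨hch j S hS, hl, hn, lab.1, lab.2, hlabS, hlt lab.1 lab.2 hlabS⟩
  refine (sissR_sum_cover_le _ _ _ _ sissR_wt_nonneg hdecomp).trans ?_
  have hinner : ∀ c : Fin m,
      ∑ T ∈ (Fintype.piFinset (fun _ : Fin k => U.image some)).image (fun ch => asm c r ch), (∏ e ∈ T, ((1 / 2 : ℝ) ^ k * (if e.1 = [] then (1 : ℝ) else 1 / (n : ℝ))))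
        ≤ (1 / 2 : ℝ) ^ k * ((∑ S ∈ U, (∏ e ∈ S, ((1 / 2 : ℝ) ^ k * (if e.1 = [] then (1 : ℝ) else 1 / (n : ℝ))))) / n) ^ k := by
    intro c
    refine (Finset.sum_image_le_of_nonneg fun T _ => sissR_wt_nonneg T).trans ?_
    have hw : ∀ ch ∈ Fintype.piFinset (fun _ : Fin k => U.image some),
        (∏ e ∈ asm c r ch, ((1 / 2 : ℝ) ^ k * (if e.1 = [] then (1 : ℝ) else 1 / (n : ℝ)))) = (1 / 2 : ℝ) ^ k * ∏ j : Fin k, f (ch j) := by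
      intro ch hch
      rw [Fintype.mem_piFinset] at hch
      refine sissR_wt_asm asm hasm c r ch fun j S hS => ?_
      have hmem := hch j
      rw [hS, Finset.mem_image] at hmem
      obtain ⟨S', hS', hSS⟩ := hmem
      cases hSS
      exact sissR_TS_rootCount asm hasm TS L hTS0 hTSs d S (Finset.mem_filter.1 hS').1
    rw [Finset.sum_congr rfl hw, ← Finset.mul_sum, ← Finset.prod_univ_sum]
    refine mul_le_mul_of_nonneg_left (le_of_eq ?_) (pow_nonneg (by norm_num) _)
    have hA : ∑ o ∈ U.image some, f o = (∑ S ∈ U, (∏ e ∈ S, ((1 / 2 : ℝ) ^ k * (if e.1 = [] then (1 : ℝ) else 1 / (n : ℝ))))) / n := by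
      rw [Finset.sum_image (fun S _ S' _ h => Option.some_injective _ h)]
      simp only [hf, Option.elim_some]
      rw [Finset.sum_div]
    rw [Finset.prod_const, Finset.card_univ, Fintype.card_fin, hA]
  refine (Finset.sum_le_sum fun c _ => hinner c).trans ?_
  rw [Finset.sum_const, Finset.card_univ, Fintype.card_fin, nsmul_eq_mul]
  exact le_of_eq (by ring)

/-- **Weight of the codes of root round `0`.** The locally valid codes of `TS (d+1)` with root round
`0` (bare roots, as children would have smaller rounds) have total weight at most `m·2^{-k}`. -/
theorem sissR_weight_zero (asm : Fin m → ℕ → (Fin k → Option (Finset (List (Fin k) × (Fin m × ℕ)))) → Finset (List (Fin k) × (Fin m × ℕ)))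
    (hasm : ∀ (c : Fin m) (r : ℕ) (ch : Fin k → Option (Finset (List (Fin k) × (Fin m × ℕ))))
      (e : (List (Fin k) × (Fin m × ℕ))), e ∈ asm c r ch ↔ (e = ([], (c, r)) ∨
      ∃ (j : Fin k) (S : Finset (List (Fin k) × (Fin m × ℕ))), ch j = some S ∧
        ∃ b : List (Fin k), (b, e.2) ∈ S ∧ e.1 = b ++ [j]))
    (TS : ℕ → Finset (Finset (List (Fin k) × (Fin m × ℕ)))) (L : ℕ)
    (hTS0 : ∀ T : Finset (List (Fin k) × (Fin m × ℕ)), T ∈ TS 0 ↔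
      ∃ (c : Fin m) (r : ℕ), r ≤ L ∧ T = asm c r (fun _ => none))
    (hTSs : ∀ (d : ℕ) (T : Finset (List (Fin k) × (Fin m × ℕ))), T ∈ TS (d + 1) ↔
      ∃ (c : Fin m) (r : ℕ), r ≤ L ∧ ∃ ch : Fin k → Option (Finset (List (Fin k) × (Fin m × ℕ))),
        (∀ (j : Fin k) (S : Finset (List (Fin k) × (Fin m × ℕ))), ch j = some S → S ∈ TS d) ∧ T = asm c r ch)
    (d : ℕ) :
    ∑ T ∈ (TS (d + 1)).filter (fun T => ((∀ e ∈ T, ∀ (j : Fin k) (y : Fin m) (s : ℕ), (j :: e.1, (y, s)) ∈ T →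
        s < e.2.2 ∧ ∃ j' : Fin k, ∀ lab : Fin m × ℕ, (j' :: j :: e.1, lab) ∉ T) ∧
      (∀ e ∈ T, 1 ≤ e.2.2 → (∃ (j : Fin k) (y : Fin m), (j :: e.1, (y, e.2.2 - 1)) ∈ T) ∨
        (e.1 = [] ∧ ∀ j : Fin k, ∃ lab : Fin m × ℕ, ([j], lab) ∈ T))) ∧
        ∃ y : Fin m, (([] : List (Fin k)), (y, 0)) ∈ T), (∏ e ∈ T, ((1 / 2 : ℝ) ^ k * (if e.1 = [] then (1 : ℝ) else 1 / (n : ℝ))))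
      ≤ (m : ℝ) * (1 / 2 : ℝ) ^ k := by
  have hdecomp : ∀ T ∈ (TS (d + 1)).filter (fun T => ((∀ e ∈ T, ∀ (j : Fin k) (y : Fin m) (s : ℕ), (j :: e.1, (y, s)) ∈ T →
        s < e.2.2 ∧ ∃ j' : Fin k, ∀ lab : Fin m × ℕ, (j' :: j :: e.1, lab) ∉ T) ∧
      (∀ e ∈ T, 1 ≤ e.2.2 → (∃ (j : Fin k) (y : Fin m), (j :: e.1, (y, e.2.2 - 1)) ∈ T) ∨
        (e.1 = [] ∧ ∀ j : Fin k, ∃ lab : Fin m × ℕ, ([j], lab) ∈ T))) ∧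
        ∃ y : Fin m, (([] : List (Fin k)), (y, 0)) ∈ T),
      ∃ c ∈ (univ : Finset (Fin m)), T ∈ ({asm c 0 (fun _ => none)} : Finset (Finset (List (Fin k) × (Fin m × ℕ)))) := by
    intro T hT
    rw [Finset.mem_filter] at hT
    obtain ⟨hTS, hloc, y, hy⟩ := hT
    obtain ⟨c, r', _, ch, hch, rfl⟩ := (hTSs d _).1 hTS
    have hrr : r' = 0 := by
      have := (sissR_asm_mem_nil asm hasm c r' ch (y, 0)).1 hy
      exact ((Prod.mk.inj this).2).symm
    subst hrr
    have hroots : ∀ (j : Fin k) (S : Finset (List (Fin k) × (Fin m × ℕ))), ch j = some S →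
        ∃ lab : Fin m × ℕ, (([] : List (Fin k)), lab) ∈ S := by
      intro j S hS
      obtain ⟨⟨c', r'', _, h⟩, _⟩ := sissR_TS_valid asm hasm TS L hTS0 hTSs d S (hch j S hS)
      exact ⟨(c', r''), h⟩
    obtain ⟨hsub, _⟩ := sissR_locv_asm_imp asm hasm c 0 ch hroots hloc
    -- no subtree can have a root round `< 0`
    have hnone : ch = fun _ => none := by
      funext j
      cases hS : ch j with
      | none => rfl
      | some S =>
        exfalso
        obtain ⟨lab, hlab⟩ := hroots j S hS
        exact Nat.not_lt_zero _ ((hsub j S hS).2.2 lab.1 lab.2 hlab)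
    refine ⟨c, mem_univ _, ?_⟩
    rw [Finset.mem_singleton, hnone]
  refine (sissR_sum_cover_le _ _ _ _ sissR_wt_nonneg hdecomp).trans ?_
  have hinner : ∀ c : Fin m, ∑ T ∈ ({asm c 0 (fun _ => none)} : Finset (Finset (List (Fin k) × (Fin m × ℕ)))), (∏ e ∈ T, ((1 / 2 : ℝ) ^ k * (if e.1 = [] then (1 : ℝ) else 1 / (n : ℝ))))
      = (1 / 2 : ℝ) ^ k := by
    intro c
    rw [Finset.sum_singleton, sissR_wt_asm asm hasm c 0 (fun _ => none) (fun j S hS => absurd hS (by simp))]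
    simp
  rw [Finset.sum_congr rfl (fun c _ => hinner c), Finset.sum_const, Finset.card_univ, Fintype.card_fin,
    nsmul_eq_mul]

/-- **No bare root of round `≥ 1` is locally valid** (`k ≥ 1`): it has neither a recent child nor a
full set of children. -/
theorem sissR_weight_base_empty (asm : Fin m → ℕ → (Fin k → Option (Finset (List (Fin k) × (Fin m × ℕ)))) → Finset (List (Fin k) × (Fin m × ℕ)))
    (hasm : ∀ (c : Fin m) (r : ℕ) (ch : Fin k → Option (Finset (List (Fin k) × (Fin m × ℕ))))
      (e : (List (Fin k) × (Fin m × ℕ))), e ∈ asm c r ch ↔ (e = ([], (c, r)) ∨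
      ∃ (j : Fin k) (S : Finset (List (Fin k) × (Fin m × ℕ))), ch j = some S ∧
        ∃ b : List (Fin k), (b, e.2) ∈ S ∧ e.1 = b ++ [j]))
    (TS : ℕ → Finset (Finset (List (Fin k) × (Fin m × ℕ)))) (L : ℕ)
    (hTS0 : ∀ T : Finset (List (Fin k) × (Fin m × ℕ)), T ∈ TS 0 ↔
      ∃ (c : Fin m) (r : ℕ), r ≤ L ∧ T = asm c r (fun _ => none))
    (hk : 1 ≤ k) (r : ℕ) (hr : 1 ≤ r) :
    (TS 0).filter (fun T => ((∀ e ∈ T, ∀ (j : Fin k) (y : Fin m) (s : ℕ), (j :: e.1, (y, s)) ∈ T →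
        s < e.2.2 ∧ ∃ j' : Fin k, ∀ lab : Fin m × ℕ, (j' :: j :: e.1, lab) ∉ T) ∧
      (∀ e ∈ T, 1 ≤ e.2.2 → (∃ (j : Fin k) (y : Fin m), (j :: e.1, (y, e.2.2 - 1)) ∈ T) ∨
        (e.1 = [] ∧ ∀ j : Fin k, ∃ lab : Fin m × ℕ, ([j], lab) ∈ T))) ∧
        ∃ y : Fin m, (([] : List (Fin k)), (y, r)) ∈ T) = ∅ := by
  rw [Finset.filter_eq_empty_iff]
  rintro T hT ⟨⟨_, hloc2⟩, y, hy⟩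
  obtain ⟨c, r', _, rfl⟩ := (hTS0 T).1 hT
  have hrr : r' = r := by
    have := (sissR_asm_mem_nil asm hasm c r' _ (y, r)).1 hy
    exact ((Prod.mk.inj this).2).symm
  subst hrr
  have hno : ∀ (j : Fin k) (lab : Fin m × ℕ), ([j], lab) ∉ asm c r' (fun _ => none) := by
    intro j lab h
    obtain ⟨S, hS, _⟩ := (sissR_asm_mem_single asm hasm c r' _ j lab).1 h
    exact absurd hS (by simp)
  rcases hloc2 _ hy hr with ⟨j, y', hy'⟩ | ⟨_, hall⟩
  · exact hno j _ hy'
  · obtain ⟨lab, hlab⟩ := hall ⟨0, hk⟩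
    exact hno _ lab hlab

end WeightStep

end Summit.PneNP.PneNP.Theorems
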